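import Summits.QuantumFields.YangMills.Theorems.BalabanUVNodesN16EntrySqueezeJunction
import Summits.QuantumFields.YangMills.Theorems.BalabanUVNodesN16AWB16RowsOfH5Reg910Slot

/-!
# Route «BalabanUVNodes», crux K3⁸ `SpineGivenEndpointR13SepCoPHV` (stmt-QuantumFields-27366), node N16 = NE3 — THE TOP KNIT, PART (B3): THE ADAPTER ON THE N16 ∕ N27 SEAM (module
# 54A: the K3⁸ bills' eleven N16 binder texts) PRODUCED FROM NODE N16's OWN CHAIN-ENTRY OBJECT `hE` + the slot key, in the bills' own spelling (`N = 2`) — module 54A with `h5 ↦ hE`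

Cell `pub-ymgap`, seat `pub-ymgap-dag-n16-e` (R134 acceleration seat (a), strategy s2 = BY-NAME KNIT at the record; HUMAN RULING D-0062; chair R424 venue), generation 24,
module 59c (THEOREMS ONLY, 0 `def`, 0 `sorry`, standard axioms; Theses-free, importable).  `--kind proof --supports stmt-QuantumFields-27366 --as helper` (count-neutral;
proves NO registered stub).  `bears_on: R4∕N16 · edges N05 → N16, N07 → N16 · composite N27`.

WHY (HOME `HANDOFF.md` §g23 «THE TOP KNIT» (b); modules 57 p688434 · 58 p688784 · 59a · 59b).  The K3⁸ bills of record (dag-n27-c's AWB16ⱽ p644014, dag-n27-w1's MINTED twin MWBNⱽ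
p646044, and their leaves 54B ∕ 55 ∕ 56) DISPLAY node N16's eleven rows `ℓ₃ g B c' ρ c · h16 hmatch hend hradii hclass hloose hρε hρb hc`; module 54A (p647671) is the `obtain` that
produces them from node N05's ℤᵈ `h5` + node N07's slot key.  THIS MODULE is module 54A with `h5 ↦ hE` — node N16's θ-free chain-entry object «(T4ᵀ_print)_β with one `(c₁′, B, B_h)`
∀ k ≥ 1» at `M_2(ℂ)` (module 57), served by node N05's Σ-object of record through module 58's bridge `exists_entry_of_n05UniformP F 2 …` and by the ℤᵈ road alike — and `0 ≤ β`
dropped; statement otherwise VERBATIM (p646044's binder texts), proof VERBATIM over module 59b §2.  A consumer holding `hE` (or node N05's Σ-object at `stage3OfFamilyMat F 2` + module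
58) and the slot key does ONE `obtain` here and feeds AWB16ⱽ ∕ MWBNⱽ ∕ APB16ᴮ their N16 rows by name.

WHAT IS PROVED ([folklore] bookkeeping BY NAME; no estimate).  ★ `exists_letters_awb16Rows_of_entry_reg910Slot`.

HONEST FRAMING.  Bookkeeping BY NAME (re-lettering + one minted reading); no estimate.  `hE` ([Balaban1985RegularSpaces] Thm 4 p. 88 with Prop. 3's letters, Hölder member at
exponent `β` AS PRINTED, all-torus geometry, every depth, ONE threshold) and the slot key (node N07 — [Balaban1985Variational] Thm 1 (9)–(10) on the collar-slot cubes) are DISPLAYED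
hypotheses asserted for no family; nothing of Bałaban is asserted or refuted; no stub of K3⁸ v7 (`stub_rates13HV` ∕ `stub_expansion13HV`) is closed or claimed; N16 ∕ N05 ∕ N06 ∕
N07 ∕ N27 NOT discharged; counts UNMOVED (typed 28∕28 · discharged 7∕27 · A 7∕28).  One finite four-torus at fixed `ε`, Bałaban AS PRINTED — NOT ℝ⁴, NOT infinite volume, NOT
OS, NOT a mass gap; the YM mass gap (Clay) is NOT proved by any of this — R4 closes the conditional finite-𝕋⁴ rung `BalabanLadder.UV` only; no summit statement is proved by this seat.
References: [Balaban1985Variational] T. Bałaban, CMP **102** (1985) 277–309, Thm 1 p. 279; [Balaban1985RegularSpaces] T. Bałaban, CMP **99** (1985) 75–102, pp. 87–88.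
-/

set_option autoImplicit false

namespace Summit.QuantumFields.YangMills.BalabanUVNodes.N16EntryAWB16RowsOfReg910Slot

open scoped BigOperators Matrix Matrix.Norms.L2Operator
open NormedSpace

open Literature.MathematicalPhysics.QuantumFieldTheory.Balaban1983to89
open Literature.MathematicalPhysics.QuantumFieldTheory.Balaban1983to89.T4Continuum (T4Family ULoop)
open B7Prop1Explicit B7Prop2Explicit MatrixLog UnitaryModel
open T4AveragingDeficitWall hiding Site Plane Plaq Bond
open B7Eq92Concrete (mgauge)
open B8Ineq132 (covDerivFwd)
open B8Eq184Proof (cfgExp)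
open B8Eq119TwistedAxial (Restr129)
open B8Eq138LandauZd (covLap IsLandau138)
open B8Thm4TorusAt (torusLam Thm4TorusAt)
open Node00 (Stage13HParams NE3Objects₁₁ NE3Letters₁₁ ne3ConstLayerOfRecord₁₁ ne3NperOfRecord₁₁ ne3DomOfRecord₁₁ MatA)
open Summit.QuantumFields.BalabanUV.T4Continuum
open MinimalActionSandwich (IsMinimiser admissible)
open Summit.QuantumFields.YangMills.BalabanUVNodes.N16HolderDefs (N16HolderAt)
open Summit.QuantumFields.YangMills.BalabanUVNodes.N16PinnedLayer13CoPH (N16PinnedLoose N16LettersEnd N16HolderAtReading n16HolderAtReading_iff_of_pinnedLoose)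
open Summit.QuantumFields.YangMills.BalabanUVNodes.N16EntrySqueezeJunction (exists_letters_n16HolderAtReading_loose_squeezeJunction_of_entry_reg910Slot)
open YMDAG.N14.TopBorn (ne1OfRecord)
open Literature.MathematicalPhysics.QuantumFieldTheory.Balaban1983to89.Node00.U3OfKernels (objectsOfRecord₁₃)
open MinimalActionRate (sfClass)
open MinimalActionRefine (gradConst)
open NE3.LeafIndexSockets (LeafH3sup)
open YMDAG.UVSplit (ne3OfRecord₁₁ RateReading₁₃CoPH)

noncomputable section
variable {β : ℝ}

/-- **★ THE ADAPTER — MWBNⱽ ∕ AWB16ⱽ's ELEVEN N16 BINDER TEXTS FROM `hE` + THE SLOT KEY.**  From node N16's chain-entry object `hE` at exponent `β ∈ [0, 1]` and node N07's slot key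
(`G hGm hG C hR`, module 53's binders at `N = 2`): letters `ℓ₃ g B c' ρ c` with `hend`, `hmatch`, the floor, `hradii`, `hclass`, the family-level `h16`, `hloose`, `hρε`,
`hρb`, `hc` (p646044's binder texts VERBATIM) and the junction range rows.  Module 53 §2 re-lettered (`g := gradConst 4 ∘ c'`, `ρ := B₃·(ε∕B)`, `c := 16937·ρ`); `h16`
through module 43's face at a reading minted pinned loose at `(ℓ₃, B)`. [cite: Balaban1985Variational, Thm 1 (9)–(10) p.279] [folklore] -/
theorem exists_letters_awb16Rows_of_entry_reg910Slot (hβ1 : β ≤ 1)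
    (hE : ∀ F : T4Family, ∃ B Bh c₁' : ℝ, 0 < B ∧ 0 < c₁' ∧ 16 * (B * c₁') ≤ 1 ∧
      ∀ k, 1 ≤ k → Thm4TorusAt F.L k (((ne3NperOfRecord₁₁ F 0 0 * F.L ^ k : ℕ) : ℤ)) (((F.L : ℝ) ^ k)⁻¹) c₁' (B7Prop2Explicit.unitaryUnits (Matrix (Fin 2) (Fin 2) ℂ))
        (fun _ => True) (Restr129 F.L k (torusLam k))
        (fun (α₀ α₁ : ℝ) (U₀ U' : B7Prop1Explicit.Site 4 → Fin 4 → (Matrix (Fin 2) (Fin 2) ℂ)ˣ) (u : B7Prop1Explicit.Site 4 → (Matrix (Fin 2) (Fin 2) ℂ)ˣ) =>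
          ∃ A : B7Prop1Explicit.Site 4 → Fin 4 → Matrix (Fin 2) (Fin 2) ℂ,
            (∀ x μ, IsSelfAdjoint (A x μ)) ∧
            (∀ (x : B7Prop1Explicit.Site 4) (κ μ : Fin 4), A (x + (((ne3NperOfRecord₁₁ F 0 0 * F.L ^ k : ℕ) : ℤ)) • B7Prop1Explicit.e κ) μ = A x μ) ∧
            mgauge U₀ u (cfgExp (((F.L : ℝ) ^ k)⁻¹) A) = U' ∧
            (∀ x μ, ‖A x μ‖ ≤ B * (α₀ + α₁)) ∧
            (∀ (μ : Fin 4) (x : B7Prop1Explicit.Site 4) (κ : Fin 4), ‖covDerivFwd (((F.L : ℝ) ^ k)⁻¹) U₀ μ (fun z => A z κ) x‖ ≤ B * (α₀ + α₁)) ∧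
            IsLandau138 F.L k (((F.L : ℝ) ^ k)⁻¹) Set.univ (torusLam k) U₀ A ∧
            (∀ (μ : Fin 4) (y : B7Prop1Explicit.Site 4) (κ : Fin 4),
              ‖Ad (U₀ y μ) (covDerivFwd (((F.L : ℝ) ^ k)⁻¹) U₀ μ (fun z => A z κ) (y + B7Prop1Explicit.e μ)) -
                  covDerivFwd (((F.L : ℝ) ^ k)⁻¹) U₀ μ (fun z => A z κ) y‖ ≤ Bh * (α₀ + α₁) * (((F.L : ℝ)⁻¹) ^ k) ^ β) ∧
            (∀ (x : B7Prop1Explicit.Site 4) (κ : Fin 4), ‖covLap (((F.L : ℝ) ^ k)⁻¹) U₀ (fun z => A z κ) x‖ ≤ B * (α₀ + α₁))))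
    {G : T4Family → (B7Prop1Explicit.Site 4 → Fin 4 → (Node00.MatA 2)ˣ) → B7Prop1Explicit.Site 4 → ℕ → ℝ → ℝ → ℝ → Prop}
    (hGm : ∀ F, MinimalActionDictionary.RadiiMono 4 (G F))
    (hG : ∀ (F : T4Family) (U : B7Prop1Explicit.Site 4 → Fin 4 → (Node00.MatA 2)ˣ) (x : B7Prop1Explicit.Site 4) (K : ℕ) (α₀ α₁ α₂ : ℝ), 2 ≤ K → G F U x K α₀ α₁ α₂ →
      ∃ (u : B7Prop1Explicit.Site 4 → (Node00.MatA 2)ˣ) (a : B7Prop1Explicit.Site 4 → Fin 4 → Node00.MatA 2),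
        (∀ z, u z ∈ B7Prop2Explicit.unitaryUnits (Node00.MatA 2)) ∧
        (∀ (y : B7Prop1Explicit.Site 4) (τ : Fin 4), B7Prop1Explicit.l1 (y - x) ≤ 2 →
          ((B7Prop1Explicit.gaugeAct u U y τ : (Node00.MatA 2)ˣ) : Node00.MatA 2) = NormedSpace.exp (a y τ)) ∧
        (∀ (y : B7Prop1Explicit.Site 4) (τ : Fin 4), B7Prop1Explicit.l1 (y - x) ≤ 2 → ‖a y τ‖ ≤ α₀) ∧
        (∀ (y : B7Prop1Explicit.Site 4) (τ i : Fin 4), B7Prop1Explicit.l1 (y - x) ≤ 1 → ‖AveragingDeficitLatticeH2Prep.fd i (fun z => a z τ) y‖ ≤ α₁) ∧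
        (∀ (τ i l : Fin 4), ‖AveragingDeficitLatticeH2Prep.fd i (AveragingDeficitLatticeH2Prep.fd l (fun z => a z τ)) x‖ ≤ α₂))
    (C : T4Family → B11Thm1.Consts)
    (hR : ∀ (F : T4Family) (k : ℕ) (ε₁ : ℝ), 0 < ε₁ → ε₁ ≤ (C F).a₁ → ∀ (V U : B7Prop1Explicit.Site 4 → Fin 4 → (Node00.MatA 2)ˣ),
      V ∈ sfClass 4 F.L (ne3NperOfRecord₁₁ F 0 0) ε₁ 0 →
      IsMinimiser 4 (sfClass 4 F.L (ne3NperOfRecord₁₁ F 0 0) ((C F).B₃ * ε₁)) F.L (ne3NperOfRecord₁₁ F 0 0) (k + 1) V U →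
        ∀ x : B7Prop1Explicit.Site 4, B11.Regularity (MinimalActionDictionary.torusVP 4 F.L (ne3NperOfRecord₁₁ F 0 0) (G F) (k + 1)) (C F).B₃ (C F).B₄ ε₁ U
          (x, F.L ^ (k + 1) - 1 + F.L ^ (k + 1) + 2)) :
    ∃ (ℓ₃ : T4Family → NE3Letters₁₁) (g B c' ρ c : T4Family → ℝ),
      N16LettersEnd 2 g ℓ₃ ∧
      (∀ F : T4Family, 0 < B F ∧ (ℓ₃ F).ε / B F ≤ (ℓ₃ F).b) ∧
      (∀ F : T4Family, (C F).B₃ ≤ B F ∧ (2 : ℝ) ^ 78 * (F.L : ℝ) ^ 12 ≤ B F) ∧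
      (∀ F : T4Family, (ℓ₃ F).g = gradConst 4 (c' F) ∧ 0 ≤ c' F ∧ 0 < c' F ∧ (ℓ₃ F).b ≤ c' F ∧
          (2 : ℝ) ^ 91 * (F.L : ℝ) ^ 17 * c' F ≤ 1 ∧ (2 : ℝ) ^ 76 * (F.L : ℝ) ^ 12 * c' F ≤ (ℓ₃ F).ε ∧ (ℓ₃ F).ε / B F ≤ 1 / 4 ∧ 4 * ((ℓ₃ F).ε / B F) ≤ c' F) ∧
      (∀ F : T4Family, 16 * B7Prop2Explicit.C0 4 * (ℓ₃ F).ε ≤ 3 ∧ 1024 * (4 + 1) * (4 + 4) * (F.L : ℝ) ^ 2 * (ℓ₃ F).ε ≤ 1) ∧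
      (∀ (F : T4Family), (∃ θ : Stage13HParams F 2, θ.Provisos₁₃CoPH F 2 ∧ (θ.ZhUnity F 2 ∧ θ.SlotsNondegenerate₁₃ F 2) ∧ θ.Admissible F 2) →
          N16HolderAt (ne3OfRecord₁₁ F { ne3ConstLayerOfRecord₁₁ F 2 (ℓ₃ F) with
            dom := {V | V ∈ ne3DomOfRecord₁₁ F 2 0 0 ∧ V ∈ sfClass 4 F.L (ne3NperOfRecord₁₁ F 0 0) ((ℓ₃ F).ε / B F) 0} }) β) ∧
      (∀ F : T4Family, LeafH3sup 4 F.L (ne3NperOfRecord₁₁ F 0 0) (ρ F) (ρ F) (c F)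
          ({V | V ∈ ne3DomOfRecord₁₁ F 2 0 0 ∧ V ∈ sfClass 4 F.L (ne3NperOfRecord₁₁ F 0 0) ((ℓ₃ F).ε / B F) 0} : Set (B7Prop1Explicit.Site 4 → Fin 4 → (Node00.MatA 2)ˣ))) ∧
      (∀ F : T4Family, ρ F ≤ (ℓ₃ F).ε) ∧
      (∀ F : T4Family, ρ F ≤ (ℓ₃ F).b) ∧
      (∀ F : T4Family, c F ≤ c' F) ∧
      (∀ F : T4Family, g F = gradConst 4 (c' F) ∧ ρ F = (C F).B₃ * ((ℓ₃ F).ε / B F) ∧ c F = 16937 * ρ F ∧ 0 < ρ F ∧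
        ρ F ≤ (C F).B₃ * (C F).a₁ ∧ ρ F ≤ 1 / 28) := by
  obtain ⟨ℓ₃, B, c', hend, hmatch, hB3, hrad, hhold, hleaf, hρ⟩ :=
    exists_letters_n16HolderAtReading_loose_squeezeJunction_of_entry_reg910Slot (N := 2) hβ1 hE hGm hG C hR
  refine ⟨ℓ₃, fun F => gradConst 4 (c' F), B, c', fun F => (C F).B₃ * ((ℓ₃ F).ε / B F), fun F => 16937 * ((C F).B₃ * ((ℓ₃ F).ε / B F)),
    hend, hmatch, hB3, fun F => ?_, fun F => ?_, fun F hF => ?_, fun F => hleaf F, fun F => (hρ F).2.1, fun F => (hρ F).2.2.1, fun F => (hρ F).2.2.2.1,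
    fun F => ⟨rfl, rfl, rfl, (hρ F).1, (hρ F).2.2.2.2.1, (hρ F).2.2.2.2.2⟩⟩
  · -- node N19′'s eight radii rows
    obtain ⟨h1, h2, h3, h4, h5', h6, -, -, h9, h10⟩ := hrad F
    exact ⟨h1, h2, h3, h4, h5', h6, h9, h10⟩
  · -- the two class-radius rows
    obtain ⟨-, -, -, -, -, -, h7, h8, -, -⟩ := hrad F
    exact ⟨h7, h8⟩
  · -- `h16` at the family level: module 43's face at a reading MINTED pinned loose at `(ℓ₃, B)` (dag-n27-w1's minting p608315; only the NE3 component is read —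
    -- U3 letters zero, the N15 component the EMPTY paired family, N14's `ne1OfRecord 1 0`)
    obtain ⟨θ, hP, -, -⟩ := hF
    let lit : (F' : T4Family) → (θ' : Stage13HParams F' 2) → θ'.Provisos₁₃CoPH F' 2 → (ℕ → ℝ) → List (ULoop F') → Node00.RateObjects₁₁ 2 :=
      fun F' θ' _ _ _ =>
        ⟨objectsOfRecord₁₃ F' 2 θ'.toStage13Params ⟨0, 0, 0, 0, 0, 0, 0⟩,
          fun _ => { ne3ConstLayerOfRecord₁₁ F' 2 (ℓ₃ F') with
            dom := {V | V ∈ ne3DomOfRecord₁₁ F' 2 0 0 ∧ V ∈ sfClass 4 F'.L (ne3NperOfRecord₁₁ F' 0 0) ((ℓ₃ F').ε / B F') 0} },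
          fun _ => ⟨PEmpty, 0, 0, (fun i => nomatch i), (fun i => nomatch i), (fun i => nomatch i), (fun i => nomatch i), (fun i => nomatch i),
            (fun i => nomatch i)⟩⟩
    let 𝔯 : RateReading₁₃CoPH 2 := ⟨lit, ne1OfRecord 1 0⟩
    have hpinL : N16PinnedLoose 𝔯 ℓ₃ B := fun _ _ _ _ _ _ => rfl
    exact (n16HolderAtReading_iff_of_pinnedLoose β hpinL).1 (hhold 𝔯 hpinL) F ⟨θ, hP⟩

end

end Summit.QuantumFields.YangMills.BalabanUVNodes.N16EntryAWB16RowsOfReg910Slot
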